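import Literature.AlgebraicTopology.KTheory.Basic
import Mathlib.Analysis.Normed.Ring.Units
import Mathlib.Analysis.Matrix.Normed
import Mathlib.Analysis.Normed.Module.FiniteDimension
import Mathlib.Topology.Homotopy.Equiv
import Mathlib.Topology.Homotopy.Contractible
import HarnessLib

/-!
# Homotopy invariance of `K⁰`

For a compact space `X`, homotopic maps `f ≃ g : X → Y` induce the same homomorphism
`f^* = g^* : K⁰(Y) → K⁰(X)` (`pullback_eq_of_homotopic`); consequently a homotopy equivalence of
compact spaces induces an isomorphism (`pullbackEquiv`) and `K⁰` of a compact contractible space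
is `ℤ` by the rank at any point (`rankAtEquivOfContractible`). This is the homotopy invariance of
vector bundles (Husemöller–Joachim–Jurčo–Schottenloher, Part II intro and Ch. 6 Thm. 6.4,
Cor. 6.5: "homotopic maps induce isomorphic bundles") in the idempotent model
`K⁰(X) = K₀(C(X, ℂ))` of `Basic.lean`, where it is proved by the standard Banach-algebra device:

* `conjugator p q = p q + (1 - p)(1 - q)` satisfies `p z = z q`, `z(p, p) = 1` and
  `1 - z = (2p - 1)(p - q)`; in a normed ring `‖1 - z‖ < 1` makes `z` a unit
  (`isUnit_conjugator`), so *close idempotents are conjugate*;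
* for continuous idempotent-valued families `P, Q : X → Mₙ(ℂ)` with `‖1 - z(P(x), Q(x))‖ < 1`
  pointwise, `x ↦ z(x)` and `x ↦ z(x)⁻¹` are continuous and conjugate `Q` into `P`, so `P ∼ Q`
  over `C(X, ℂ)` (`idemOfFun_equiv_of_norm_lt`; no compactness);
* for a family `H` on `X × [0, 1]` with `X` compact, nearby slices are uniformly close
  (`exists_forall_norm_one_sub_conjugator_lt`, a compactness argument on `X × [0,1]²`), so all
  slices are algebraically equivalent by a finite chain (`slice_equiv_slice`) — this is the
  matrix form of Thm. 6.4 (`E' ≅ (E'|B×{t}) × [0, 1]` up to isomorphism of restrictions);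
* applied to `H(x, t) = p(F(t, x))` for a homotopy `F`: `f^* p ∼ g^* p` for every idempotent `p`
  over `C(Y, ℂ)` (`map_comapRingHom_equiv_of_homotopic`, the unstable statement = Cor. 6.5), and
  `f^* = g^*` on `K⁰` (`pullback_eq_of_homotopic`).

Corollaries: `pullbackEquiv` (homotopy equivalences), `homotopic_of_contractibleSpace`,
`rankAt_eq_rankAt_of_contractibleSpace`, `rankAtEquivOfContractible : K0 X ≃+ ℤ`,
`of_eq_of_unit_of_contractible` (`[p] = [1_{rank p}]`) and `equiv_map_const_of_contractible`
(over a compact contractible space every idempotent family is algebraically equivalent to a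
constant one). Everything is proved; no named facts.

## References

* D. Husemöller, M. Joachim, B. Jurčo, M. Schottenloher, *Basic Bundle Theory and K-Cohomology
  Invariants*, LNP 726 (2008) [HusemollerEtAl2008] (held; PDF pp. 165–166, 174): Part II
  introduction ("homotopy invariance of bundles": `f'^{-1}(E) ≅ f''^{-1}(E)` for homotopic
  `f', f''`), Ch. 6 Thm. 6.4 (bundles over `B × [0,1]`), Cor. 6.5 (homotopic maps induce
  isomorphic bundles), Def. 4.4 (homotopy invariant functor); Ch. 4 Rem. 2.4 (`K(*) = ℤ`).

## Design notes

* The matrix norm is Mathlib's `Matrix.linftyOpNormedRing` as a *local* instance (any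
  submultiplicative norm inducing the product topology would do; this one is definitionally the
  product topology, so `C(X, Mₙ(ℂ))` needs no conversion).
* The chain in `slice_equiv_slice` runs along `N + 1` equal steps of the segment from `s` to `t`
  (`segPoint`), with `1/(N+1) < δ`.
* Mathlib searches: `Units.oneSub`, `NormedRing.inverse_continuousAt`, `IsCompact.exists_isMinOn`,
  `ContinuousMap.Homotopic.comp`, `id_nullhomotopic`, `ContractibleSpace.hequiv` (used). No
  homotopy invariance of `K₀`/vector bundles in Mathlib. Nothing restated.
-/

noncomputable section

namespace Literature.AlgebraicTopology.KTheory

open Literature.RingTheory.KTheory Matrix unitInterval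

universe u v

/-! ### The conjugator `z = pq + (1 - p)(1 - q)` of two idempotents -/

section Ring

variable {A : Type*} [Ring A]

/-- The **conjugator** `z(p, q) = p q + (1 - p)(1 - q)` of two elements of a ring: for idempotents
`p z = z q` (`= p q`), `z(p, p) = 1`, and `1 - z = (2p - 1)(p - q)`, so that `z` is invertible
and conjugates `q` into `p` as soon as `q` is close to `p` (the standard device behind the homotopy
invariance of `K₀`; cf. Husemöller et al., Ch. 3 Prop. 5.8). [folklore] -/
def conjugator (p q : A) : A := p * q + (1 - p) * (1 - q)

/-- `p z(p, q) = p q` for an idempotent `p`. [folklore] -/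
theorem mul_conjugator {p : A} (hp : IsIdempotentElem p) (q : A) : p * conjugator p q = p * q := by
  simp only [conjugator, mul_add, ← mul_assoc, mul_sub, mul_one, hp.eq, sub_self, zero_mul, add_zero]

/-- `z(p, q) q = p q` for an idempotent `q`. [folklore] -/
theorem conjugator_mul (p : A) {q : A} (hq : IsIdempotentElem q) : conjugator p q * q = p * q := by
  simp only [conjugator, add_mul, mul_assoc, sub_mul, one_mul, hq.eq, sub_self, mul_zero, add_zero]

/-- `p z = z q` for idempotents `p, q`. [folklore] -/
theorem mul_conjugator_eq {p q : A} (hp : IsIdempotentElem p) (hq : IsIdempotentElem q) :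
    p * conjugator p q = conjugator p q * q := by
  rw [mul_conjugator hp, conjugator_mul p hq]

/-- `z(p, p) = 1` for an idempotent `p`. [folklore] -/
theorem conjugator_self {p : A} (hp : IsIdempotentElem p) : conjugator p p = 1 := by
  simp only [conjugator, mul_sub, sub_mul, one_mul, mul_one, hp.eq]; abel

/-- `1 - z(p, q) = (2p - 1)(p - q)` for an idempotent `p`. [folklore] -/
theorem one_sub_conjugator {p : A} (hp : IsIdempotentElem p) (q : A) :
    1 - conjugator p q = (2 * p - 1) * (p - q) := by
  simp only [conjugator, mul_sub, sub_mul, one_mul, mul_one, two_mul, add_mul, hp.eq]; abel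

end Ring

section NormedRing

variable {A : Type*} [NormedRing A]

/-- `‖1 - z(p, q)‖ ≤ ‖2p - 1‖ ‖p - q‖`. [folklore] -/
theorem norm_one_sub_conjugator_le {p : A} (hp : IsIdempotentElem p) (q : A) :
    ‖1 - conjugator p q‖ ≤ ‖2 * p - 1‖ * ‖p - q‖ := by
  rw [one_sub_conjugator hp]; exact norm_mul_le _ _

/-- If `‖1 - z‖ < 1` the conjugator is a unit (geometric series). [folklore] -/
theorem isUnit_conjugator [HasSummableGeomSeries A] {p q : A} (h : ‖1 - conjugator p q‖ < 1) :
    IsUnit (conjugator p q) := by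
  simpa using (Units.oneSub (1 - conjugator p q) h).isUnit

end NormedRing

/-! ### Close families of idempotent matrices are algebraically equivalent -/

section Matrix

attribute [local instance] Matrix.linftyOpNormedRing Matrix.linftyOpNormedAlgebra

variable {X : Type u} {Y : Type v} [TopologicalSpace X] [TopologicalSpace Y] {n : ℕ}

/-- Two representatives built from equal families are equal. [folklore] -/
theorem idemOfFun_congr {P P' : C(X, Matrix (Fin n) (Fin n) ℂ)} (h : P = P')
    (hP : ∀ x, IsIdempotentElem (P x)) (hP' : ∀ x, IsIdempotentElem (P' x)) :
    idemOfFun P hP = idemOfFun P' hP' := by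
  subst h; rfl

/-- The conjugator of two continuous families, as a continuous family. [folklore] -/
def conjugatorMap (P Q : C(X, Matrix (Fin n) (Fin n) ℂ)) : C(X, Matrix (Fin n) (Fin n) ℂ) where
  toFun x := conjugator (P x) (Q x)
  continuous_toFun := by
    unfold conjugator
    exact (P.continuous.mul Q.continuous).add
      ((continuous_const.sub P.continuous).mul (continuous_const.sub Q.continuous))

/-- Values of `conjugatorMap`. [folklore] -/
@[simp] theorem conjugatorMap_apply (P Q : C(X, Matrix (Fin n) (Fin n) ℂ)) (x : X) :
    conjugatorMap P Q x = conjugator (P x) (Q x) := rfl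

/-- **Close continuous families of idempotent matrices are algebraically equivalent over `C(X, ℂ)`.**
If `P, Q : X → Mₙ(ℂ)` are continuous idempotent-valued with `‖1 - z(P(x), Q(x))‖ < 1` for all `x`
(e.g. `‖2P(x) - 1‖ ‖P(x) - Q(x)‖ < 1`), then `z(x) = P(x)Q(x) + (1 - P(x))(1 - Q(x))` is a
continuous family of invertible matrices with `Q(x) = z(x)⁻¹ P(x) z(x)`, so `P ∼ Q` as idempotent
matrices over the ring `C(X, ℂ)` (no compactness needed). [folklore] -/
theorem idemOfFun_equiv_of_norm_lt (P Q : C(X, Matrix (Fin n) (Fin n) ℂ))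
    (hP : ∀ x, IsIdempotentElem (P x)) (hQ : ∀ x, IsIdempotentElem (Q x))
    (h : ∀ x, ‖1 - conjugator (P x) (Q x)‖ < 1) : idemOfFun P hP ≈ idemOfFun Q hQ := by
  have hunit : ∀ x, IsUnit (conjugator (P x) (Q x)) := fun x ↦ isUnit_conjugator (h x)
  have hinv : ∀ x, ContinuousAt Ring.inverse (conjugatorMap P Q x) := fun x ↦ by
    have := NormedRing.inverse_continuousAt (hunit x).unit
    rwa [IsUnit.unit_spec] at this
  let U : C(X, Matrix (Fin n) (Fin n) ℂ) :=
    ⟨fun x ↦ Ring.inverse (conjugatorMap P Q x), continuous_iff_continuousAt.2 fun x ↦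
      (hinv x).comp (conjugatorMap P Q).continuous.continuousAt⟩
  refine algEquivalent_of_conj (idemOfFun P hP).isIdempotentElem U (conjugatorMap P Q)
    (fun x ↦ Ring.mul_inverse_cancel _ (hunit x)) fun x ↦ ?_
  change matrixSwap (matrixUnswap Q) x = Ring.inverse (conjugator (P x) (Q x)) *
    matrixSwap (matrixUnswap P) x * conjugator (P x) (Q x)
  rw [show matrixSwap (matrixUnswap Q) x = Q x from congrFun (congrArg _ ((matrixSwapEquiv X _ _).right_inv Q)) x,
    show matrixSwap (matrixUnswap P) x = P x from congrFun (congrArg _ ((matrixSwapEquiv X _ _).right_inv P)) x,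
    mul_assoc, mul_conjugator_eq (hP x) (hQ x), Ring.inverse_mul_cancel_left _ _ (hunit x)]

/-- The sufficient condition `‖2P(x) - 1‖ ‖P(x) - Q(x)‖ < 1`. [folklore] -/
theorem idemOfFun_equiv_of_norm_mul_norm_lt (P Q : C(X, Matrix (Fin n) (Fin n) ℂ))
    (hP : ∀ x, IsIdempotentElem (P x)) (hQ : ∀ x, IsIdempotentElem (Q x))
    (h : ∀ x, ‖2 * P x - 1‖ * ‖P x - Q x‖ < 1) : idemOfFun P hP ≈ idemOfFun Q hQ :=
  idemOfFun_equiv_of_norm_lt P Q hP hQ fun x ↦ (norm_one_sub_conjugator_le (hP x) _).trans_lt (h x)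

/-! ### Homotopies of idempotent families -/

/-- The time-`t` slice `x ↦ H(x, t)` of a family over `X × [0, 1]`. [folklore] -/
def slice (H : C(X × I, Matrix (Fin n) (Fin n) ℂ)) (t : I) : C(X, Matrix (Fin n) (Fin n) ℂ) :=
  H.comp ((ContinuousMap.id X).prodMk (ContinuousMap.const X t))

/-- `slice H t x = H (x, t)`. [folklore] -/
@[simp] theorem slice_apply (H : C(X × I, Matrix (Fin n) (Fin n) ℂ)) (t : I) (x : X) :
    slice H t x = H (x, t) := rfl

/-- **Uniform closeness of nearby slices** (compactness): for a continuous idempotent-valued `H`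
on `X × [0, 1]` with `X` compact there is `δ > 0` with `‖1 - z(H(x, s), H(x, t))‖ < 1` whenever
`|s - t| < δ`. (The set where this fails is compact and misses the diagonal `s = t`, on which the
quantity vanishes.) [folklore] -/
theorem exists_forall_norm_one_sub_conjugator_lt [CompactSpace X] (H : C(X × I, Matrix (Fin n) (Fin n) ℂ))
    (hH : ∀ z, IsIdempotentElem (H z)) :
    ∃ δ > (0 : ℝ), ∀ (x : X) (s t : I), dist s t < δ → ‖1 - conjugator (H (x, s)) (H (x, t))‖ < 1 := by
  let F : X × I × I → ℝ := fun z ↦ ‖1 - conjugator (H (z.1, z.2.1)) (H (z.1, z.2.2))‖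
  have hF : Continuous F := by
    refine continuous_norm.comp (continuous_const.sub ?_)
    unfold conjugator
    have h1 : Continuous fun z : X × I × I ↦ H (z.1, z.2.1) := H.continuous.comp (by fun_prop)
    have h2 : Continuous fun z : X × I × I ↦ H (z.1, z.2.2) := H.continuous.comp (by fun_prop)
    exact (h1.mul h2).add ((continuous_const.sub h1).mul (continuous_const.sub h2))
  let C : Set (X × I × I) := {z | 1 ≤ F z}
  have hC : IsCompact C := (isClosed_le continuous_const hF).isCompact
  by_cases hne : C.Nonempty
  · obtain ⟨z₀, hz₀, hmin⟩ :=
      hC.exists_isMinOn hne (f := fun z : X × I × I ↦ dist z.2.1 z.2.2) (by fun_prop)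
    have hpos : 0 < dist z₀.2.1 z₀.2.2 := by
      rw [dist_pos]
      intro heq
      have : F z₀ = 0 := by
        simp only [F, heq, conjugator_self (hH _), sub_self, norm_zero]
      exact absurd hz₀ (by simp only [C, Set.mem_setOf_eq, this, not_le]; exact one_pos)
    refine ⟨dist z₀.2.1 z₀.2.2, hpos, fun x s t hst ↦ ?_⟩
    by_contra hge
    exact absurd (hmin (a := (x, s, t)) (not_lt.1 hge)) (not_le.2 hst)
  · refine ⟨1, one_pos, fun x s t _ ↦ ?_⟩
    by_contra hge
    exact hne ⟨(x, s, t), not_lt.1 hge⟩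

/-- Points of `[0, 1]` on the segment from `s` to `t`: `(1 - c) s + c t`. [folklore] -/
def segPoint (s t c : I) : I :=
  ⟨(1 - c) * s + c * t, by
    constructor
    · nlinarith [s.2.1, s.2.2, t.2.1, t.2.2, c.2.1, c.2.2]
    · nlinarith [s.2.1, s.2.2, t.2.1, t.2.2, c.2.1, c.2.2]⟩

/-- The real number underlying `segPoint s t c`. [folklore] -/
@[simp] theorem coe_segPoint (s t c : I) : (segPoint s t c : ℝ) = (1 - c) * s + c * t := rfl

/-- **All slices of a homotopy of idempotent families are algebraically equivalent** (`X` compact):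
chain `s = u₀, u₁, …, u_N = t` with `|u_{k+1} - u_k| < δ` and use
`idemOfFun_equiv_of_norm_lt` and transitivity. This is the homotopy invariance of
`Vect(X) ≅ Idem(C(X))` (Husemöller et al., Ch. 6 Thm. 6.4 for bundles over `B × [0, 1]`).
[cite: HusemollerEtAl2008, Ch. 6 Cor. 6.5] -/
theorem slice_equiv_slice [CompactSpace X] (H : C(X × I, Matrix (Fin n) (Fin n) ℂ))
    (hH : ∀ z, IsIdempotentElem (H z)) (s t : I) :
    idemOfFun (slice H s) (fun _ ↦ hH _) ≈ idemOfFun (slice H t) (fun _ ↦ hH _) := by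
  obtain ⟨δ, hδ, hclose⟩ := exists_forall_norm_one_sub_conjugator_lt H hH
  obtain ⟨N, hN⟩ := exists_nat_one_div_lt hδ
  -- u k = segPoint s t (k / (N+1))
  let c : ℕ → I := fun k ↦ ⟨min ((k : ℝ) / (N + 1)) 1, by
    constructor
    · exact le_min (by positivity) zero_le_one
    · exact min_le_right _ _⟩
  have hc : ∀ k ≤ N + 1, ((c k : I) : ℝ) = k / (N + 1) := fun k hk ↦ by
    change min _ _ = _
    rw [min_eq_left]
    rw [div_le_one (by positivity)]
    exact_mod_cast hk
  have step : ∀ k, k + 1 ≤ N + 1 →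
      idemOfFun (slice H (segPoint s t (c k))) (fun _ ↦ hH _) ≈
        idemOfFun (slice H (segPoint s t (c (k + 1)))) (fun _ ↦ hH _) := by
    intro k hk
    refine idemOfFun_equiv_of_norm_lt _ _ _ _ fun x ↦ hclose x _ _ ?_
    change dist (segPoint s t (c k)) (segPoint s t (c (k + 1))) < δ
    rw [Subtype.dist_eq, Real.dist_eq, coe_segPoint, coe_segPoint, hc k (by omega), hc (k + 1) hk]
    have hst : |(s : ℝ) - t| ≤ 1 := by
      rw [abs_le]; constructor <;> linarith [s.2.1, s.2.2, t.2.1, t.2.2]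
    calc |(1 - (k : ℝ) / (N + 1)) * s + k / (N + 1) * t - ((1 - (k + 1 : ℕ) / (N + 1)) * s + (k + 1 : ℕ) / (N + 1) * t)|
        = |(s : ℝ) - t| * (1 / (N + 1)) := by
          rw [← abs_of_pos (show (0 : ℝ) < 1 / (N + 1) by positivity), ← abs_mul]
          congr 1; push_cast; ring
      _ ≤ 1 * (1 / (N + 1)) := by gcongr
      _ < δ := by rw [one_mul]; exact hN
  have chain : ∀ k ≤ N + 1,
      idemOfFun (slice H (segPoint s t (c 0))) (fun _ ↦ hH _) ≈
        idemOfFun (slice H (segPoint s t (c k))) (fun _ ↦ hH _) := by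
    intro k hk
    induction k with
    | zero => exact Setoid.refl _
    | succ k ih => exact (ih (by omega)).trans (step k hk)
  have h0 : segPoint s t (c 0) = s := Subtype.ext (by simp [hc 0 (by omega)])
  have h1 : segPoint s t (c (N + 1)) = t := Subtype.ext (by
    rw [coe_segPoint, hc (N + 1) le_rfl, Nat.cast_add_one, div_self (by positivity)]; ring)
  have := chain (N + 1) le_rfl
  rwa [h0, h1] at this

/-! ### Homotopy invariance of `K⁰` -/

/-- **Homotopic maps induce algebraically equivalent pull-backs of every idempotent** (`X` compact):
for `f ≃ g : X → Y` and `p` an idempotent matrix over `C(Y, ℂ)`, `f^* p ∼ g^* p` over `C(X, ℂ)`.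
This is the matrix form of "`f^*(E) ≅ g^*(E)` for homotopic `f, g`" (Husemöller et al., Part II intro
and Ch. 6 Cor. 6.5). [cite: HusemollerEtAl2008, Ch. 6 Cor. 6.5] -/
theorem map_comapRingHom_equiv_of_homotopic [CompactSpace X] {f g : C(X, Y)} (h : f.Homotopic g)
    (p : Idem C(Y, ℂ)) : p.map (comapRingHom f) ≈ p.map (comapRingHom g) := by
  obtain ⟨F⟩ := h
  let H : C(X × I, Matrix (Fin p.size) (Fin p.size) ℂ) :=
    (matFun p).comp (F.toContinuousMap.comp (ContinuousMap.prodSwap (α := X) (β := I)))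
  have hH : ∀ z, IsIdempotentElem (H z) := fun z ↦ isIdempotentElem_matFun p _
  have hs0 : slice H 0 = matFun (p.map (comapRingHom f)) := by
    ext x : 1
    change matFun p (F (0, x)) = _
    rw [F.apply_zero]; rfl
  have hs1 : slice H 1 = matFun (p.map (comapRingHom g)) := by
    ext x : 1
    change matFun p (F (1, x)) = _
    rw [F.apply_one]; rfl
  have key := slice_equiv_slice H hH 0 1
  have e0 : idemOfFun (slice H 0) (fun _ ↦ hH _) = p.map (comapRingHom f) := by
    rw [idemOfFun_congr hs0 _ (isIdempotentElem_matFun _)]; exact idemOfFun_matFun _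
  have e1 : idemOfFun (slice H 1) (fun _ ↦ hH _) = p.map (comapRingHom g) := by
    rw [idemOfFun_congr hs1 _ (isIdempotentElem_matFun _)]; exact idemOfFun_matFun _
  rw [e0, e1] at key
  exact key

/-- **Homotopy invariance of `K⁰`**: homotopic maps `f ≃ g : X → Y` from a compact space induce
the same homomorphism `f^* = g^* : K⁰(Y) → K⁰(X)` (Husemöller et al., Ch. 6 Cor. 6.5 with
Ch. 4 Thm. 3.5: `K` is a homotopy invariant functor, Ch. 6 Def. 4.4). [cite: HusemollerEtAl2008, Ch. 6 Cor. 6.5] -/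
theorem pullback_eq_of_homotopic [CompactSpace X] {f g : C(X, Y)} (h : f.Homotopic g) :
    pullback f = pullback g :=
  KZero.hom_ext fun p ↦ by
    rw [pullback_of, pullback_of]
    exact KZero.of_eq_of (map_comapRingHom_equiv_of_homotopic h p)

/-- **A homotopy equivalence of compact spaces induces an isomorphism on `K⁰`.**
[cite: HusemollerEtAl2008, Ch. 6 Cor. 6.5] -/
def pullbackEquiv [CompactSpace X] [CompactSpace Y] (e : ContinuousMap.HomotopyEquiv X Y) :
    K0 Y ≃+ K0 X :=
  (pullback e.toFun).toAddEquiv (pullback e.invFun)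
    (by rw [← pullback_comp, pullback_eq_of_homotopic e.right_inv, pullback_id])
    (by rw [← pullback_comp, pullback_eq_of_homotopic e.left_inv, pullback_id])

/-- `pullbackEquiv e` is `e.toFun^*`. [cite: HusemollerEtAl2008, Ch. 6 Cor. 6.5] -/
@[simp] theorem pullbackEquiv_apply [CompactSpace X] [CompactSpace Y] (e : ContinuousMap.HomotopyEquiv X Y)
    (a : K0 Y) : pullbackEquiv e a = pullback e.toFun a := rfl

/-- Any two maps into a contractible space are homotopic. [folklore] -/
theorem homotopic_of_contractibleSpace [ContractibleSpace Y] (f g : C(X, Y)) : f.Homotopic g := by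
  obtain ⟨y, hy⟩ := id_nullhomotopic Y
  have hf : f.Homotopic (ContinuousMap.const X y) := by
    simpa using ContinuousMap.Homotopic.comp hy (ContinuousMap.Homotopic.refl f)
  have hg : g.Homotopic (ContinuousMap.const X y) := by
    simpa using ContinuousMap.Homotopic.comp hy (ContinuousMap.Homotopic.refl g)
  exact hf.trans hg.symm

/-- On a contractible space the rank does not depend on the base point. [folklore] -/
theorem rankAt_eq_rankAt_of_contractibleSpace [ContractibleSpace X] (x x' : X) :
    (rankAt x : K0 X →+ ℤ) = rankAt x' := by
  have h := pullback_eq_of_homotopic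
    (homotopic_of_contractibleSpace (ContinuousMap.const PUnit.{1} x) (ContinuousMap.const PUnit.{1} x'))
  ext a
  have hx := rankAt_pullback (ContinuousMap.const PUnit.{1} x) PUnit.unit a
  have hx' := rankAt_pullback (ContinuousMap.const PUnit.{1} x') PUnit.unit a
  simp only [ContinuousMap.const_apply] at hx hx'
  rw [← hx, ← hx', h]

/-- **`K⁰` of a compact contractible space is `ℤ`, by the rank at any point** (homotopy invariance
+ `K⁰(pt) = ℤ`). [cite: HusemollerEtAl2008, Ch. 6 Cor. 6.5] -/
def rankAtEquivOfContractible [CompactSpace X] [ContractibleSpace X] (x : X) : K0 X ≃+ ℤ :=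
  AddEquiv.ofBijective (rankAt x) <| by
    obtain ⟨e⟩ := ContractibleSpace.hequiv X PUnit.{u + 1}
    have hb : Function.Bijective ((rankAtEquiv PUnit.unit).toAddMonoidHom.comp (pullbackEquiv e).symm.toAddMonoidHom) :=
      (rankAtEquiv PUnit.unit).bijective.comp (pullbackEquiv e).symm.bijective
    convert hb using 1
    ext a
    change rankAt x a = rankAt PUnit.unit (pullback e.invFun a)
    rw [rankAt_pullback, rankAt_eq_rankAt_of_contractibleSpace x (e.invFun PUnit.unit)]

/-- `rankAtEquivOfContractible x` is `rankAt x`. [cite: HusemollerEtAl2008, Ch. 4 Rem. 2.4] -/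
@[simp] theorem rankAtEquivOfContractible_apply [CompactSpace X] [ContractibleSpace X] (x : X) (a : K0 X) :
    rankAtEquivOfContractible x a = rankAt x a := rfl

/-- Over a compact contractible space every idempotent family is *stably* equivalent to a constant
free one: `[p] = [1ᵣ]` in `K⁰(X)` with `r = rank_x p`. [cite: HusemollerEtAl2008, Ch. 6 Cor. 6.5] -/
theorem of_eq_of_unit_of_contractible [CompactSpace X] [ContractibleSpace X] (x : X) (p : Idem C(X, ℂ)) :
    KZero.of p = KZero.of (Idem.unit (p.map (evalRingHom x)).rank) :=
  (rankAtEquivOfContractible x).injective <| by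
    rw [rankAtEquivOfContractible_apply, rankAtEquivOfContractible_apply, rankAt_of, rankAt_of_unit]

/-- Over a compact contractible space every idempotent family is algebraically equivalent to the
constant family of its value at any point (unstably: pull back along `id ≃ const`).
[cite: HusemollerEtAl2008, Ch. 6 Cor. 6.5] -/
theorem equiv_map_const_of_contractible [CompactSpace X] [ContractibleSpace X] (x : X) (p : Idem C(X, ℂ)) :
    p ≈ p.map (comapRingHom (ContinuousMap.const X x)) := by
  have h := map_comapRingHom_equiv_of_homotopic
    (homotopic_of_contractibleSpace (ContinuousMap.id X) (ContinuousMap.const X x)) p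
  rwa [comapRingHom_id] at h

end Matrix

end Literature.AlgebraicTopology.KTheory

end
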